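import Summits.BirchSwinnertonDyer.BirchSwinnertonDyer.Theorems.ThetaPartnerAtTwoSignedKatoUpToAtTwoKatoValueTransfer
import Summits.BirchSwinnertonDyer.BirchSwinnertonDyer.Theorems.ThetaPartnerAtTwoSignedKatoUpToAtTwoHondaLogCharSum
import HarnessLib

/-!
# Route `ThetaPartnerAtTwo` (TP2), crux K3 `SignedKatoDivisibilityUpToAtTwo` (stmt-BirchSwinnertonDyer-20308 / K3P′ 25631), line
# `colemanrat` v13 — glue for the kernel assembly: the `p`-ADIC READING of Kato's cyclotomic values (`e : ℚ(ζ_{p^k}) → ℚ̄_p` with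
# `e(ζ) = ζ_{p^k}`, `e ∘ σ_b = τ_b • e`, Gauss sums / character sums along `e`) and the DESCENT of `ℂ_p`-valued Dirichlet characters to `ℚ̄_p`

Width seat `bsd-wall-tp2-p2x-w4` g0 (cell `bsd-wall`); offered 12:03Z as (D1)/(D2) for the lead's `coreChiPrim_of_coreKBK` (memo
`Cruxes/SignedKatoDivisibilityUpToAtTwo/G7-ASSEMBLY-v1.md`: "character descent ℂ₂ ↔ PadicAlgCl 2", "`e ∘ σ_b = τ_b • e` on CyclotomicField").
HONEST FRAMING: theorems only (no definition, no named fact, no instance, no `sorry`); field/Galois bookkeeping; closes no item; K3 / K3P′ are NOT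
settled and BSD is NOT proved by any of this.

## What

* §1 (any `m`, any characteristic-`0` field `C`) `exists_ringHom_zeta_eq` (an embedding `e : CyclotomicField m ℚ → C` with `e(ζ_m) = μ` for any
  primitive `m`-th root `μ ∈ C`), `ringHom_ext_zeta` (two such embeddings agreeing on `ζ_m` are equal), `map_sigma_eq_of_apply_zeta`
  (`e(σ_b y) = φ(e y)` for any ring endomorphism `φ` of `C` with `φ(e ζ_m) = e(ζ_m)^b` — Kato's `σ_b`, `EulerSystemValues.sigma`, (5.7.1)).
* §2 (`C = ℚ̄_p = PadicAlgCl p`, the tree's tower `PadicCyclotomicTower.zeta p k`, modulus `m = p^k` up to PROPOSITIONAL equality `hm : m = p^k`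
  so that both `m = p^k` and `m = cycLevel p k ∅` are served): `exists_ringHom_zeta_eq_padicZeta`, **`map_sigma_eq_smul`** (`e(σ_b y) = τ • e(y)`
  whenever `τ • ζ_{p^k} = ζ_{p^k}^b`), `map_zmodChar_eq_zmodChar`, `map_gaussSum_eq` (`e(τ_F(ψ)) = τ_{ℚ̄_p}(ψ_e)`), `map_charSumF_eq_sum_smul`
  (`e(Σ_b ψ⁻¹(b)σ_b y) = Σ_b ψ_e⁻¹(b)·τ_b • e(y)` for a family `τ_b` with `τ_b ζ = ζ^b` — the right-hand factor of the lead's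
  `KatoBK.sum_pow_mul_trace_eq_mul`).
* §3 `exists_ringHomComp_algebraMap_eq` (**descent `ℂ_p → ℚ̄_p`**): every Dirichlet character `χ` modulo `m` with values in `ℂ_[p]` is
  `ψ.ringHomComp (algebraMap (PadicAlgCl p) ℂ_[p])` for a unique `ℚ̄_p`-valued `ψ` (its values are roots of unity, and those of `ℂ_p` come from
  `ℚ̄_p`); primitivity, parity and order transfer by the tree's `isPrimitive_ringHomComp_iff`, `even_ringHomComp_iff`, `orderOf_ringHomComp`.

References: [Kato2004Asterisque] (5.7.1) (p. 157), Thm. 6.6 (1) (p. 163); [Washington1997] Ch. 2 Thm. 2.5; [Kobayashi2003] §8.4.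
-/

set_option autoImplicit false
-- the Theorems namespace of this sub repeats the summit name by design (D-0017 nested layout)
set_option linter.dupNamespace false
-- `IsCyclotomicExtension {m} ℚ (CyclotomicField m ℚ)` through `NeZero ((m : ℕ) : ℚ)` (as in `EulerSystemValues.sigma`)
set_option backward.isDefEq.respectTransparency false

noncomputable section

open scoped BigOperators NumberField

open Polynomial Literature.NumberTheory.EllipticCurves Literature.NumberTheory.EllipticCurves.Kato2004
  Literature.NumberTheory.EllipticCurves.Kato2004.EulerSystemValues
  Summit.BirchSwinnertonDyer.Rank1Residual.Additive

namespace Summit.BirchSwinnertonDyer.BirchSwinnertonDyer.Theorems.SignedKatoOffTwo.KatoValue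

/-! ## §1 Embeddings of `ℚ(ζ_m)` pinned at `ζ_m` -/

section Generic

variable {m : ℕ} [NeZero m] {C : Type*} [Field C] [CharZero C]

/-- **An embedding `e : ℚ(ζ_m) → C` with `e(ζ_m) = μ`** for every primitive `m`-th root of unity `μ` of a characteristic-`0` field `C`
(`Φ_m` irreducible over `ℚ`; `IsPrimitiveRoot.embeddingsEquivPrimitiveRoots`). [cite: Washington1997, Ch. 2 Thm. 2.5] -/
theorem exists_ringHom_zeta_eq {μ : C} (hμ : IsPrimitiveRoot μ m) :
    ∃ e : CyclotomicField m ℚ →+* C, e (IsCyclotomicExtension.zeta m ℚ (CyclotomicField m ℚ)) = μ := by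
  have hζ := IsCyclotomicExtension.zeta_spec m ℚ (CyclotomicField m ℚ)
  have hirr : Irreducible (cyclotomic m ℚ) := cyclotomic.irreducible_rat (NeZero.pos m)
  have hμ' : μ ∈ primitiveRoots m C := (mem_primitiveRoots (NeZero.pos m)).mpr hμ
  refine ⟨((hζ.embeddingsEquivPrimitiveRoots C hirr).symm ⟨μ, hμ'⟩).toRingHom, ?_⟩
  have h := congrArg Subtype.val ((hζ.embeddingsEquivPrimitiveRoots C hirr).apply_symm_apply ⟨μ, hμ'⟩)
  rw [IsPrimitiveRoot.embeddingsEquivPrimitiveRoots_apply_coe] at h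
  exact h

/-- **Embeddings of `ℚ(ζ_m)` are determined by the image of `ζ_m`** (`ℚ(ζ_m)` has the power basis of `ζ_m`). [cite: Washington1997, Ch. 2 Thm. 2.5] -/
theorem ringHom_ext_zeta (e₁ e₂ : CyclotomicField m ℚ →+* C)
    (h : e₁ (IsCyclotomicExtension.zeta m ℚ (CyclotomicField m ℚ)) = e₂ (IsCyclotomicExtension.zeta m ℚ (CyclotomicField m ℚ))) :
    e₁ = e₂ := by
  have hζ := IsCyclotomicExtension.zeta_spec m ℚ (CyclotomicField m ℚ)
  have hA : e₁.toRatAlgHom = e₂.toRatAlgHom := by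
    refine (hζ.powerBasis ℚ).algHom_ext ?_
    rw [IsPrimitiveRoot.powerBasis_gen]
    exact h
  have := congrArg (fun A : CyclotomicField m ℚ →ₐ[ℚ] C ↦ (A : CyclotomicField m ℚ →+* C)) hA
  simpa using this

/-- **Kato's `σ_b` under an embedding**: if a ring endomorphism `φ` of `C` satisfies `φ(e ζ_m) = e(ζ_m)^b`, then `e(σ_b y) = φ(e y)` for all
`y ∈ ℚ(ζ_m)` (`σ_b ζ_m = ζ_m^b`, `EulerSystemValues.sigma_apply_zeta`; both sides are embeddings agreeing on `ζ_m`).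
[cite: Kato2004Asterisque, (5.7.1) (p. 157)] -/
theorem map_sigma_eq_of_apply_zeta (e : CyclotomicField m ℚ →+* C) (φ : C →+* C) (b : (ZMod m)ˣ)
    (h : φ (e (IsCyclotomicExtension.zeta m ℚ (CyclotomicField m ℚ))) =
      e (IsCyclotomicExtension.zeta m ℚ (CyclotomicField m ℚ)) ^ (b : ZMod m).val) (y : CyclotomicField m ℚ) :
    e (sigma m b y) = φ (e y) := by
  have key := ringHom_ext_zeta (e.comp (sigma m b).toRingEquiv.toRingHom) (φ.comp e) (by
    rw [RingHom.comp_apply, RingHom.comp_apply, h]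
    change e (sigma m b _) = _
    rw [sigma_apply_zeta, map_pow])
  exact RingHom.congr_fun key y

end Generic

/-! ## §2 The `p`-adic reading: `e(ζ) = ζ_{p^k} ∈ ℚ̄_p`, `e ∘ σ_b = τ_b • e` -/

section Padic

variable (p : ℕ) [Fact p.Prime] (k : ℕ) {m : ℕ} [NeZero m] (hm : m = p ^ k)

include hm in
/-- **An embedding `e : ℚ(ζ_{p^k}) → ℚ̄_p` with `e(ζ) = ζ_{p^k}`**, the tree's tower root `PadicCyclotomicTower.zeta p k` (stated for any
modulus `m` PROPOSITIONALLY equal to `p^k`, e.g. `cycLevel p k ∅`). [cite: Kobayashi2003, §8.4] -/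
theorem exists_ringHom_zeta_eq_padicZeta :
    ∃ e : CyclotomicField m ℚ →+* PadicAlgCl p,
      e (IsCyclotomicExtension.zeta m ℚ (CyclotomicField m ℚ)) = PadicCyclotomicTower.zeta p k := by
  refine exists_ringHom_zeta_eq ?_
  rw [hm]
  exact PadicCyclotomicTower.isPrimitiveRoot_zeta p k

variable {p k}

/-- **`e ∘ σ_b = τ • e`**: for `e(ζ) = ζ_{p^k}` and `τ ∈ Γ_{ℚ_p}` with `τ ζ_{p^k} = ζ_{p^k}^b`, `e(σ_b y) = τ • e(y)` for all `y ∈ ℚ(ζ_{p^k})`.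
[cite: Kato2004Asterisque, (5.7.1) (p. 157)] -/
theorem map_sigma_eq_smul (e : CyclotomicField m ℚ →+* PadicAlgCl p)
    (he : e (IsCyclotomicExtension.zeta m ℚ (CyclotomicField m ℚ)) = PadicCyclotomicTower.zeta p k)
    (τ : Field.absoluteGaloisGroup ℚ_[p]) (b : (ZMod m)ˣ)
    (hτ : τ • PadicCyclotomicTower.zeta p k = PadicCyclotomicTower.zeta p k ^ (b : ZMod m).val) (y : CyclotomicField m ℚ) :
    e (sigma m b y) = τ • e y := by
  have h := map_sigma_eq_of_apply_zeta e (MulSemiringAction.toRingHom _ (PadicAlgCl p) τ) b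
    (by rw [MulSemiringAction.toRingHom_apply, he, hτ]) y
  rw [h, MulSemiringAction.toRingHom_apply]

omit [NeZero m] in
include hm in
/-- `ζ_{p^k}^m = 1` for `m = p^k` (plumbing for `AddChar.zmodChar m`). [folklore] -/
theorem padicZeta_pow_eq_one : PadicCyclotomicTower.zeta p k ^ m = 1 := by
  rw [hm]; exact (PadicCyclotomicTower.isPrimitiveRoot_zeta p k).pow_eq_one

/-- **Additive characters along `e`**: `e(ζ_F^a) = ζ_{p^k}^a`. [folklore] -/
theorem map_zmodChar_eq_zmodChar (e : CyclotomicField m ℚ →+* PadicAlgCl p)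
    (he : e (IsCyclotomicExtension.zeta m ℚ (CyclotomicField m ℚ)) = PadicCyclotomicTower.zeta p k)
    (hz : PadicCyclotomicTower.zeta p k ^ m = 1) (a : ZMod m) :
    e (AddChar.zmodChar m (IsCyclotomicExtension.zeta_spec m ℚ (CyclotomicField m ℚ)).pow_eq_one a) = AddChar.zmodChar m hz a := by
  rw [AddChar.zmodChar_apply, AddChar.zmodChar_apply, map_pow, he]

/-- **Gauss sums along `e`**: `e(Σ_a ψ(a)ζ_F^a) = Σ_a ψ_e(a) ζ_{p^k}^a`, `ψ_e = ψ.ringHomComp e`. [cite: Washington1997, Lemma 4.7] -/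
theorem map_gaussSum_eq (e : CyclotomicField m ℚ →+* PadicAlgCl p)
    (he : e (IsCyclotomicExtension.zeta m ℚ (CyclotomicField m ℚ)) = PadicCyclotomicTower.zeta p k)
    (hz : PadicCyclotomicTower.zeta p k ^ m = 1) (ψ : DirichletCharacter (CyclotomicField m ℚ) m) :
    e (gaussSum ψ (AddChar.zmodChar m (IsCyclotomicExtension.zeta_spec m ℚ (CyclotomicField m ℚ)).pow_eq_one)) =
      gaussSum (ψ.ringHomComp e) (AddChar.zmodChar m hz) := by
  rw [gaussSum, gaussSum, map_sum]
  refine Finset.sum_congr rfl fun a _ ↦ ?_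
  rw [map_mul, MulChar.ringHomComp_apply, map_zmodChar_eq_zmodChar e he hz]

/-- **Kato's character sum along `e`, as a Galois-orbit sum**: for a family `τ_a ∈ Γ_{ℚ_p}` with `τ_a ζ_{p^k} = ζ_{p^k}^a` on units,
`e(Σ_b ψ⁻¹(b) σ_b y) = Σ_b ψ_e⁻¹(b) · τ_b • e(y)` — the right-hand factor of `KatoBK.sum_pow_mul_trace_eq_mul`.
[cite: Kato2004Asterisque, (5.7.1) (p. 157), Thm. 6.6 (1) (p. 163)] -/
theorem map_charSumF_eq_sum_smul (e : CyclotomicField m ℚ →+* PadicAlgCl p)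
    (he : e (IsCyclotomicExtension.zeta m ℚ (CyclotomicField m ℚ)) = PadicCyclotomicTower.zeta p k)
    (τ : ZMod m → Field.absoluteGaloisGroup ℚ_[p])
    (hτ : ∀ a : ZMod m, IsUnit a → τ a • PadicCyclotomicTower.zeta p k = PadicCyclotomicTower.zeta p k ^ a.val)
    (ψ : DirichletCharacter (CyclotomicField m ℚ) m) (y : CyclotomicField m ℚ) :
    e (∑ b : (ZMod m)ˣ, ψ⁻¹ (b : ZMod m) * sigma m b y) =
      ∑ b : (ZMod m)ˣ, (ψ.ringHomComp e)⁻¹ (b : ZMod m) * τ (b : ZMod m) • e y := by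
  rw [map_sum]
  refine Finset.sum_congr rfl fun b _ ↦ ?_
  rw [map_mul, MulChar.ringHomComp_inv, MulChar.ringHomComp_apply,
    map_sigma_eq_smul e he (τ (b : ZMod m)) b (hτ _ (Units.isUnit b)) y]

end Padic

/-! ## §3 Descent of `ℂ_p`-valued Dirichlet characters to `ℚ̄_p` -/

section Descent

variable (p : ℕ) [Fact p.Prime]

/-- **Roots of unity of `ℂ_p` come from `ℚ̄_p`**: if `ξ ∈ ℂ_[p]` has `ξ^N = 1` (`N ≥ 1`) then `ξ = y` for some `y ∈ PadicAlgCl p` with `y^N = 1`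
(the `N` roots of `X^N − 1` in the algebraically closed `ℚ̄_p` exhaust those of the field `ℂ_p`). [folklore] -/
theorem exists_algebraMap_eq_of_pow_eq_one {N : ℕ} (hN : N ≠ 0) {ξ : ℂ_[p]} (hξ : ξ ^ N = 1) :
    ∃ y : PadicAlgCl p, y ^ N = 1 ∧ algebraMap (PadicAlgCl p) ℂ_[p] y = ξ := by
  haveI : NeZero N := ⟨hN⟩
  obtain ⟨ζ₀, hζ₀⟩ := HasEnoughRootsOfUnity.exists_primitiveRoot (PadicAlgCl p) N
  have hζ₁ : IsPrimitiveRoot (algebraMap (PadicAlgCl p) ℂ_[p] ζ₀) N :=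
    hζ₀.map_of_injective (algebraMap (PadicAlgCl p) ℂ_[p]).injective
  obtain ⟨i, -, hi⟩ := hζ₁.eq_pow_of_pow_eq_one hξ
  exact ⟨ζ₀ ^ i, by rw [← pow_mul, mul_comm, pow_mul, hζ₀.pow_eq_one, one_pow], by rw [map_pow, hi]⟩

/-- **Descent `ℂ_p → ℚ̄_p` for Dirichlet characters.** Every `χ : DirichletCharacter ℂ_[p] m` is `ψ.ringHomComp (algebraMap (PadicAlgCl p) ℂ_[p])`
for some `ψ : DirichletCharacter (PadicAlgCl p) m` (the values `χ(u)`, `u` a unit, are `|(ℤ/m)ˣ|`-th roots of unity, hence images of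
roots of unity of `ℚ̄_p`; multiplicativity of the chosen preimages by injectivity). Primitivity, parity and order of `ψ` are those of `χ`
(`isPrimitive_ringHomComp_iff`, `even_ringHomComp_iff`, `orderOf_ringHomComp`). [folklore] -/
theorem exists_ringHomComp_algebraMap_eq {m : ℕ} [NeZero m] (χ : DirichletCharacter ℂ_[p] m) :
    ∃ ψ : DirichletCharacter (PadicAlgCl p) m, ψ.ringHomComp (algebraMap (PadicAlgCl p) ℂ_[p]) = χ := by
  classical
  set ι := algebraMap (PadicAlgCl p) ℂ_[p] with hι
  have hinj : Function.Injective ι := (algebraMap (PadicAlgCl p) ℂ_[p]).injective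
  -- every value on a unit is a root of unity, hence an `ι`-image
  have hroot : ∀ u : (ZMod m)ˣ, χ (u : ZMod m) ^ Fintype.card (ZMod m)ˣ = 1 := by
    intro u
    rw [← MulChar.coe_toUnitHom, ← Units.val_pow_eq_pow_val, ← map_pow, pow_card_eq_one, map_one, Units.val_one]
  have hex : ∀ u : (ZMod m)ˣ, ∃ y : PadicAlgCl p, ι y = χ (u : ZMod m) := by
    intro u
    obtain ⟨y, -, hy⟩ := exists_algebraMap_eq_of_pow_eq_one p Fintype.card_ne_zero (hroot u)
    exact ⟨y, hy⟩
  choose g hg using hex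
  have hg1 : g 1 = 1 := hinj (by rw [hg, Units.val_one, map_one, map_one])
  have hgmul : ∀ u v : (ZMod m)ˣ, g (u * v) = g u * g v := fun u v ↦
    hinj (by rw [hg, map_mul, Units.val_mul, map_mul, hg, hg])
  have hg0 : ∀ u : (ZMod m)ˣ, g u ≠ 0 := by
    intro u h0
    have h := hg u
    rw [h0, map_zero] at h
    have hne : χ (u : ZMod m) ≠ 0 := by
      rw [← MulChar.coe_toUnitHom]; exact (χ.toUnitHom u).ne_zero
    exact hne h.symm
  -- the unit-valued homomorphism and the descended character
  let f : (ZMod m)ˣ →* (PadicAlgCl p)ˣ :=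
    { toFun := fun u ↦ Units.mk0 (g u) (hg0 u)
      map_one' := Units.ext (by simp [hg1])
      map_mul' := fun u v ↦ Units.ext (by simp [hgmul]) }
  refine ⟨MulChar.ofUnitHom f, MulChar.ext fun u ↦ ?_⟩
  rw [MulChar.ringHomComp_apply, MulChar.ofUnitHom_eq, MulChar.equivToUnitHom_symm_coe]
  exact hg u

/-- The descended character has the same primitivity, parity and order. [folklore] -/
theorem exists_ringHomComp_algebraMap_eq' {m : ℕ} [NeZero m] (χ : DirichletCharacter ℂ_[p] m) :
    ∃ ψ : DirichletCharacter (PadicAlgCl p) m, ψ.ringHomComp (algebraMap (PadicAlgCl p) ℂ_[p]) = χ ∧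
      (ψ.IsPrimitive ↔ χ.IsPrimitive) ∧ (ψ.Even ↔ χ.Even) ∧ orderOf ψ = orderOf χ := by
  obtain ⟨ψ, hψ⟩ := exists_ringHomComp_algebraMap_eq p χ
  refine ⟨ψ, hψ, ?_, ?_, ?_⟩
  · rw [← hψ, isPrimitive_ringHomComp_iff]
  · rw [← hψ, even_ringHomComp_iff]
  · rw [← hψ, orderOf_ringHomComp]

end Descent

end Summit.BirchSwinnertonDyer.BirchSwinnertonDyer.Theorems.SignedKatoOffTwo.KatoValue

end
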